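import Summits.QuantumFields.YangMills.Theses.DualityDefect
import Literature.MathematicalPhysics.QuantumFieldTheory.MassGapFromLatticeClustering

/-!
# Birth skeleton (BC3) for crux `DefectRemainderToClay` — stmt-QuantumFields-15927
(route `DualityDefect`, rank 6; sub-problem `YangMills`; published as
`Cruxes/DefectRemainderToClay/Lines/birth.lean`)

Registrar `planner-skel-stmt-QuantumFields-15927-0`, 2026-08-17 (skeleton-register one-shot; route
re-audit bin REPAIRABLE). Crux decl:
`Summit.QuantumFields.YangMills.Theses.DualityDefect.DefectRemainderToClay` — for every compact simple
`G` and faithful unitary `r`: the `(G, r)`-clauses of `DefectUnimodal` (X₁: one peak `t⋆(β, μ) ≥ ℓ(β) → ∞`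
of the channel ratio `R = B/A` in every infinite-volume limit state `μ` at every `β ≥ β₀`) and of
`PeakSetsTheGap` (X₂: from the point where `R` stops rising for good, the scalar clover channel decays
at rate `c₁/t`) imply the `(G, r)`-clause of `YangMills` (∃ weak-coupling scheme `sch`, OS data `T`:
`HasWeakCouplingLimit ∧ IsYangMillsFor ∧ IsNontrivial ∧ IsNonGaussian ∧ ∃ Δ > 0, HasMassGap Δ ∧
HasLatticeMassGap Δ`). "The rest of Clay given X", with the lattice spacing set by the peak.

## Why this cut (four stubs)

The route text says X enters the remainder three times — (i) SCALE `a_k ∝ 1/t⋆(β_k)`, (ii) the scalar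
channel GAPPED at rate `c₁/t⋆`, (iii) non-triviality — and that everything else is owed. Typed against
the tree this splits into four genuinely different obligations, and the route-review refuter's caveats
(REVIEW.md §3 on the item: (a) X does not bound the peak by the scalar correlation length, which
`IsNontrivial` of an `a_k ∝ 1/t⋆` scheme needs; (b) X gives neither `k`-uniform constants nor the
torus-uniform form of `HasLatticeMassGap`) become two of them, named:

* `stub_uniformPeak` — **the peak is a function of `β`** (lattice, infinite-volume states; size M–L):
  X₁ gives a peak `t⋆(β, μ)` PER limit state; the scale `a_k` must not depend on the state, so the peaks
  at fixed `β` must be bounded over `infiniteVolumeLimitPoints r.ρ β` and the maximal one attained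
  (`T(β)`, itself a peak of some state, `≥ ℓ(β)`). Why it might fail: a continuum of coexisting limit
  states at a bulk transition of some faithful `r` with unbounded peaks; needs the (named, unproved)
  non-emptiness / Gibbs property of the limit points. Sources: OsterwalderSeiler1978 §4, arXiv:1803.01950 §2.
* `stub_peakAlive` — **the peak lies within the scalar correlation length** (caveat (a); lattice; size L):
  at its peak the scalar clover channel is still alive, `A(t⋆) > 0` and `A(2t⋆) ≥ δ·A(t⋆)` with ONE
  `δ > 0` for all large `β` and all states — i.e. `t⋆ ≲ ξ_S`, the converse of X₂'s `ξ_S ≲ t⋆`; without it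
  the spacing `1/T(β)` undershoots the correlation length and the continuum limit is ultralocal
  (barrier `FixedCouplingUltralocality` in disguise; the refuter's toy moment sequences satisfy X with
  `t⋆/ξ_S → ∞`). Why it might fail: the rise is driven by slow logarithmic running, nothing ties the
  turning point to `ξ_S` within a bounded factor. Sources: arXiv:hep-lat/0503015, arXiv:hep-ph/9410372.
* `stub_scalarGapSetsLatticeGap` — **the scalar clover channel dominates the lattice spectrum,
  volume-uniformly** (caveat (b); lattice; open/XL): exponential decay at rate `m` of `Cov(S₀, S_{ne₀})` in
  EVERY infinite-volume limit state at `β` ⇒ clustering of ALL pairs of gauge-invariant local observables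
  on all large odd tori (`latticeConnectedCorr`, `n ≤ S`) at rate `κ·m`, with pair constants uniform in
  `β ≥ β₀` and `m ≤ m₀` and pair-uniform volume thresholds — "half-spectrum channel subadditivity" plus
  the transfer-matrix gap, the torus-uniform form `HasLatticeMassGap` needs. Why it might fail: a state
  lighter than `κ·m(0⁺⁺)` in another `J^PC` channel for some `(G, r)`, zero overlap of the clover density
  with a light scalar, torelon / thermal effects on the torus. Sources: OsterwalderSeiler1978 §§2–4,
  doi:10.1007/bf01614090, arXiv:hep-lat/9901004, GlimmJaffe1987 §6.1.
* `stub_continuumLimitOnPeakTrajectory` — **the continuum limit on the peak trajectory** (UV/OS core;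
  open-problem): a volume-uniform torus gap of all pairs at rate `Δ₀/T(β)` with `T(β) → ∞` AND aliveness
  of the scalar channel at the same scale `T(β)` ⇒ along SOME weak-coupling sequence `β_k → ∞` with
  `a_k T(β_k) = θ` and tori beyond the gap threshold, the renormalised joint Schwinger functions of all
  species converge to OS data (`IsYangMillsFor`), non-trivial and non-Gaussian in `tr F²`, with
  Cauchy–Schwarz clustering at the physical rate `Δ₀/θ` (`SpeciesScheme.HasCSClustering`, the tree's
  transferable currency). Why it might fail: it is the UV half of Clay on a NON-perturbatively defined
  trajectory — E1 rotations/universality, E0′ bounds, non-Gaussianity of `tr F²`, and the passage from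
  pair-constant exponential clustering to the norm (transfer-matrix) form are all open (barriers
  `UVStabilityNonUniqueness`, `PerturbativeInvisibility`). Sources: Balaban1988Convergent,
  MagnenRivasseauSeneor1993, OsterwalderSchrader1975, JaffeWitten2000 §§5–6, Luscher1977.

Composition `DefectRemainderToClay_of : stub₁ → stub₂ → stub₃ → stub₄ → DefectRemainderToClay`
(hypotheses spelled `__Registered.stub_X`, name-keyed abbreviations of the stub statements, for the
native audit) is a real proof, no `sorry`: unpack X₁, X₂ (the crux's `let`-bound bodies are
definitionally `Unimodal G r → PeakGap G r → ClayClause G r`); raise the threshold `β⋆` until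
`ℓ(β) > t₀, ≥ t₀ˢ, ≥ t₁`; Stub 1 gives the state-uniform peak `T(β)`; X₂ at each state's own peak plus
`t⋆(β, μ) ≤ T(β)` (monotonicity of the rate, `decay_mono`) gives scalar decay at rate `c₁/T(β)` in every
state; Stub 3 turns it into the torus gap of all pairs at rate `κc₁/T(β)`; Stub 2 at the maximal peak
gives aliveness at scale `T(β)`; `T ≥ ℓ → ∞`; Stub 4 builds the scheme and the OS data; the continuum
gap clause is READ OFF by the tree theorem `IsYangMillsFor.hasMassGap_of_hasCSClustering` and
`HasLatticeMassGap r sch (κc₁/θ)` is the torus gap transported along `a_k T(β_k) = θ`. No stub is the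
crux or the summit reworded: Stubs 1–3 are lattice statements, Stub 4 has hypotheses X does not
supply (state-uniform all-pair torus gap, aliveness) and a conclusion in lattice currency.

## Disproof used / negatives

None for THIS crux: `ledger crux ls stmt-QuantumFields-15927` lists no workfiles (no `Disproof.lean`,
no `Theorems/DefectRemainderToClay/Negative/*`) on 2026-08-17. Sibling Negative lemmas honoured:
`ClusteringToYangMills/Negative/DisproofBurden` (`clustering_perVolume`: per-volume constants are
contentless — every clustering clause here has `∃ C` BEFORE `∀ S`; `not_clusteringAllTimes_at`: the
thermal restriction `n ≤ S` is kept; `yangMillsShape_without_nontriviality`: Stub 4 carries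
`IsNontrivial ∧ IsNonGaussian ∧ HasWeakCouplingLimit`); `OSLegsFromFemtoAndGap/Negative/ForallSchemeFalse`
(`not_forall_scheme_strengthening`, `not_isNontrivial_of_curv_unrenormalised`: the scheme and its
renormalisations are EXISTENTIAL witness data of Stub 4, never universally quantified);
`GapToContinuum` D2/D3b (uniformities missing from `HasLatticeMassGap`-type hypotheses): here the
β-uniform constants and pair-uniform thresholds are DEMANDED of Stub 3's conclusion, so the transport
in the composition is honest bookkeeping. `ledger negatives --problem QuantumFields`: none related.

## BC3 audit

See `Lines/birth.md` (farm `lean check --json`: rc 0, sorries 4 = stubs, probes 8/8 + 16/16 fail).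
-/

noncomputable section

namespace Summit.QuantumFields.YangMills.Cruxes.DefectRemainderToClay.Birth

open Filter Topology MeasureTheory
open Literature.MathematicalPhysics.QuantumFieldTheory Literature.MathematicalPhysics.QuantumLattice

/-! ## The route's quantities, named -/

section Statements

variable {G : Type} [Group G] [TopologicalSpace G] [IsTopologicalGroup G] [CompactSpace G]
  [MeasurableSpace G] [BorelSpace G]

/-- The bare scalar clover density `S_x(U) = Σ_{μ<ν} Re tr C†C` (the route's `S`). -/
def cloverS (r : LatticeRep G) : (Fin 4 → ℤ) → LGConfig 4 G → ℝ :=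
  fun x U => flowedCloverEnergy r.ρ 0 x U

/-- The bare pseudoscalar clover density `P_x(U) = −2 Re tr(C₀₁C₂₃ − C₀₂C₁₃ + C₀₃C₁₂)` (the route's `P`). -/
def cloverP (r : LatticeRep G) : (Fin 4 → ℤ) → LGConfig 4 G → ℝ :=
  fun x U => -2 * (flowedClover r.ρ 0 U x 0 1 * flowedClover r.ρ 0 U x 2 3 -
    flowedClover r.ρ 0 U x 0 2 * flowedClover r.ρ 0 U x 1 3 +
    flowedClover r.ρ 0 U x 0 3 * flowedClover r.ρ 0 U x 1 2).trace.re

/-- The Euclidean-time axis site `n e₀` (the route's `e`). -/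
def axis : ℕ → (Fin 4 → ℤ) := fun n => (n : ℤ) • Pi.single (0 : Fin 4) (1 : ℤ)

/-- `A(μ, n) = Cov_μ(S₀, S_{ne₀})` (the route's `A`). -/
def covS (r : LatticeRep G) : Measure (LGConfig 4 G) → ℕ → ℝ :=
  fun μ n => integral μ (fun U => cloverS r 0 U * cloverS r (axis n) U) -
    integral μ (fun U => cloverS r 0 U) * integral μ (fun U => cloverS r (axis n) U)

/-- `B(μ, n) = −Cov_μ(P₀, P_{ne₀})` (the route's `B`). -/
def covP (r : LatticeRep G) : Measure (LGConfig 4 G) → ℕ → ℝ :=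
  fun μ n => integral μ (fun U => cloverP r 0 U) * integral μ (fun U => cloverP r (axis n) U) -
    integral μ (fun U => cloverP r 0 U * cloverP r (axis n) U)

/-- **`tstar` is a peak of `R = B/A` in the state `μ`, counted from `t₀`** (product form, verbatim the
three clauses of `DefectUnimodal`): strict rise on `[t₀, tstar)`, no rise at `tstar`, strict fall after. -/
def IsPeak (r : LatticeRep G) (t₀ : ℕ) (μ : Measure (LGConfig 4 G)) (tstar : ℕ) : Prop :=
  (∀ n : ℕ, t₀ ≤ n → n < tstar → covP r μ n * covS r μ (n + 1) < covP r μ (n + 1) * covS r μ n) ∧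
  covP r μ (tstar + 1) * covS r μ tstar ≤ covP r μ tstar * covS r μ (tstar + 1) ∧
  (∀ n : ℕ, tstar < n → covP r μ (n + 1) * covS r μ n < covP r μ n * covS r μ (n + 1))

omit [IsTopologicalGroup G] [CompactSpace G] [BorelSpace G] in
/-- Peaks counted from `t₀` are unique beyond `t₀` (so "the peak `t⋆(β, μ)`" of the route is well
defined wherever `ℓ(β) ≥ t₀`). -/
theorem IsPeak.unique {r : LatticeRep G} {t₀ : ℕ} {μ : Measure (LGConfig 4 G)} {t₁ t₂ : ℕ}
    (h₁ : IsPeak r t₀ μ t₁) (h₂ : IsPeak r t₀ μ t₂) (ht₁ : t₀ ≤ t₁) (ht₂ : t₀ ≤ t₂) : t₁ = t₂ := by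
  by_contra hne
  rcases Nat.lt_or_gt_of_ne hne with hlt | hgt
  · exact absurd (h₂.1 t₁ ht₁ hlt) (not_lt.2 h₁.2.1)
  · exact absurd (h₁.1 t₂ ht₂ hgt) (not_lt.2 h₂.2.1)

variable (G)

/-- **X₁ at `(G, r)`** — definitionally the `(G, r)`-clause of `DefectUnimodal`. -/
def Unimodal (r : LatticeRep G) : Prop :=
  ∃ (β₀ : ℝ) (t₀ : ℕ) (ℓ : ℝ → ℕ), Tendsto ℓ atTop atTop ∧ ∀ β : ℝ, β₀ ≤ β →
    ∀ μ ∈ infiniteVolumeLimitPoints (d := 4) r.ρ β, ∃ tstar : ℕ, ℓ β ≤ tstar ∧ IsPeak r t₀ μ tstar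

/-- **X₂ at `(G, r)`** — definitionally the `(G, r)`-clause of `PeakSetsTheGap`. -/
def PeakGap (r : LatticeRep G) : Prop :=
  ∃ (β₀ c₁ : ℝ) (t₀ : ℕ), 0 < c₁ ∧ 0 < t₀ ∧ ∀ β : ℝ, β₀ ≤ β →
    ∀ μ ∈ infiniteVolumeLimitPoints (d := 4) r.ρ β, ∀ t : ℕ, t₀ ≤ t →
      (∀ n : ℕ, t ≤ n → covP r μ (n + 1) * covS r μ n ≤ covP r μ n * covS r μ (n + 1)) →
        ∃ K : ℝ, ∀ n : ℕ, covS r μ n ≤ K * Real.exp (-(c₁ * n / t))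

/-- **The conclusion of the crux at `(G, r)`** — definitionally the `(G, r)`-clause of `YangMills`'s
witness part. -/
def ClayClause (r : LatticeRep G) : Prop :=
  ∃ (sch : SpeciesScheme (YMSpecies G)) (T : OSData (YMSpecies G) 4),
    sch.HasWeakCouplingLimit ∧ IsYangMillsFor r sch T ∧ T.IsNontrivial r.curvature ∧
      T.IsNonGaussian r.curvature ∧ ∃ Δ > 0, T.HasMassGap Δ ∧ HasLatticeMassGap r sch Δ

/-- The crux IS `∀ G r, Unimodal → PeakGap → ClayClause`, by `Iff.rfl` (the route's `let`-bound
`S, P, e, A, B` are `cloverS, cloverP, axis, covS, covP`). -/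
theorem defectRemainderToClay_iff :
    Summit.QuantumFields.YangMills.Theses.DualityDefect.DefectRemainderToClay ↔
      ∀ (G : Type) [Group G] [TopologicalSpace G] [IsTopologicalGroup G] [CompactSpace G]
        [MeasurableSpace G] [BorelSpace G], IsCompactSimpleLieGroup G →
        ∀ r : LatticeRep G, Unimodal G r → PeakGap G r → ClayClause G r :=
  Iff.rfl

/-- **Volume-uniform torus gap of ALL pairs at the scale `T(β)`**: every pair of gauge-invariant
local observables clusters in Euclidean time on every odd torus of half-side `S ≥ S₁(β)` (pair-uniform
threshold), for `n ≤ S`, at rate `Δ₀/T(β)`, with ONE constant per pair for all `β ≥ β₀`. -/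
def TorusGapAtScale (r : LatticeRep G) (β₀ Δ₀ : ℝ) (T : ℝ → ℕ) (S₁ : ℝ → ℕ) : Prop :=
  ∀ A B : YMSpecies G, ∃ C : ℝ, ∀ β : ℝ, β₀ ≤ β → ∀ S : ℕ, S₁ β ≤ S → ∀ n : ℕ, n ≤ S →
    |latticeConnectedCorr r.ρ β (2 * S + 1) A.F B.F n| ≤ C * Real.exp (-(Δ₀ / T β * n))

/-- **The scalar channel is alive at the scale `T(β)`**: in some limit state the connected scalar
clover correlation is positive at distance `T(β)` and loses at most the factor `δ` between `T(β)` and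
`2T(β)` (effective mass `≤ log(1/δ)/T(β)`: the physical correlation length at spacing `1/T(β)` is
bounded below). -/
def AliveAtScale (r : LatticeRep G) (β₀ δ : ℝ) (T : ℝ → ℕ) : Prop :=
  ∀ β : ℝ, β₀ ≤ β → ∃ μ ∈ infiniteVolumeLimitPoints (d := 4) r.ρ β,
    0 < covS r μ (T β) ∧ δ * covS r μ (T β) ≤ covS r μ (2 * T β)

/-- **A gapped, non-trivial continuum limit ON THE PEAK TRAJECTORY, in lattice currency**: a
sequential scheme with `β_k → ∞`, `β_k ≥ β₀`, tori beyond the threshold `S₁(β_k) ≤ L_k`, spacing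
commensurate with the scale, `a_k · T(β_k) = θ`, whose renormalised joint lattice Schwinger functions
converge to OS data `TT` (`IsYangMillsFor`), non-trivial and non-Gaussian in the curvature, and which
clusters in the Cauchy–Schwarz currency of the smeared fields at the physical rate `Δ₀/θ`. -/
def PeakTrajectoryLimit (r : LatticeRep G) (β₀ Δ₀ : ℝ) (T : ℝ → ℕ) (S₁ : ℝ → ℕ) : Prop :=
  ∃ (sch : SpeciesScheme (YMSpecies G)) (TT : OSData (YMSpecies G) 4) (θ : ℝ), 0 < θ ∧
    sch.HasWeakCouplingLimit ∧ (∀ k, β₀ ≤ sch.β k) ∧ (∀ k, S₁ (sch.β k) ≤ sch.L k) ∧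
    (∀ k, sch.a k * T (sch.β k) = θ) ∧ IsYangMillsFor r sch TT ∧ TT.IsNontrivial r.curvature ∧
    TT.IsNonGaussian r.curvature ∧ sch.HasCSClustering r (Δ₀ / θ)

end Statements

/-! ## Registered stubs -/

/-- **Stub 1 — the peak is a function of `β` (state-uniform peak).** For compact simple `G`, faithful
`r`, `t₀`, a window `ℓ` with `ℓ(β) > t₀` and peaks `t⋆(β, μ) ≥ ℓ(β)` in every limit state for `β ≥ β₀`:
there is `T : ℝ → ℕ` bounding every peak (`t⋆ ≤ T(β)`) and attained (`T(β)` is the peak of some limit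
state and `≥ ℓ(β)`). Lattice, infinite-volume states; size M–L. -/
theorem stub_uniformPeak :
    ∀ (G : Type) [Group G] [TopologicalSpace G] [IsTopologicalGroup G] [CompactSpace G]
      [MeasurableSpace G] [BorelSpace G], IsCompactSimpleLieGroup G →
      ∀ (r : LatticeRep G) (t₀ : ℕ) (ℓ : ℝ → ℕ) (β₀ : ℝ), (∀ β : ℝ, β₀ ≤ β → t₀ < ℓ β) →
      (∀ β : ℝ, β₀ ≤ β → ∀ μ ∈ infiniteVolumeLimitPoints (d := 4) r.ρ β,
          ∃ tstar : ℕ, ℓ β ≤ tstar ∧ IsPeak r t₀ μ tstar) →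
      ∃ T : ℝ → ℕ, ∀ β : ℝ, β₀ ≤ β →
        (∀ μ ∈ infiniteVolumeLimitPoints (d := 4) r.ρ β, ∀ tstar : ℕ, t₀ ≤ tstar →
            IsPeak r t₀ μ tstar → tstar ≤ T β) ∧
        ∃ μ ∈ infiniteVolumeLimitPoints (d := 4) r.ρ β, ℓ β ≤ T β ∧ IsPeak r t₀ μ (T β) := by
  sorry

/-- **Stub 2 — at its peak the scalar channel is alive (`t⋆ ≲ ξ_S`).** For compact simple `G`,
faithful `r` and `t₀` there are `δ > 0`, `β₁`, `t₁` such that in every limit state at `β ≥ β₁`, at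
every peak `tstar > t₀, ≥ t₁` counted from `t₀`: `A(tstar) > 0` and `A(2·tstar) ≥ δ · A(tstar)`.
Lattice; size L; the converse companion of `PeakSetsTheGap`. -/
theorem stub_peakAlive :
    ∀ (G : Type) [Group G] [TopologicalSpace G] [IsTopologicalGroup G] [CompactSpace G]
      [MeasurableSpace G] [BorelSpace G], IsCompactSimpleLieGroup G →
      ∀ (r : LatticeRep G) (t₀ : ℕ), ∃ δ : ℝ, 0 < δ ∧ ∃ (β₁ : ℝ) (t₁ : ℕ), ∀ β : ℝ, β₁ ≤ β →
        ∀ μ ∈ infiniteVolumeLimitPoints (d := 4) r.ρ β, ∀ tstar : ℕ, t₀ < tstar → t₁ ≤ tstar →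
          IsPeak r t₀ μ tstar → 0 < covS r μ tstar ∧ δ * covS r μ tstar ≤ covS r μ (2 * tstar) := by
  sorry

/-- **Stub 3 — the scalar clover channel dominates the lattice spectrum, volume-uniformly.** For
compact simple `G`, faithful `r`, `β₀ > 0`, `m₀ > 0` there are `κ > 0` and volume thresholds
`S₁(β, m)` such that for every pair of gauge-invariant local observables ONE constant `C` serves all
`β ≥ β₀` and all rates `0 < m ≤ m₀`: if `Cov(S₀, S_{ne₀}) ≤ K_μ e^{−mn}` in EVERY infinite-volume limit
state at `β`, then `|⟨A·τₙB⟩ − ⟨A⟩⟨B⟩| ≤ C e^{−κmn}` on every odd torus of half-side `S ≥ S₁(β, m)`,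
`n ≤ S`. Lattice; open/XL (half-spectrum channel subadditivity + transfer-matrix gap on the torus). -/
theorem stub_scalarGapSetsLatticeGap :
    ∀ (G : Type) [Group G] [TopologicalSpace G] [IsTopologicalGroup G] [CompactSpace G]
      [MeasurableSpace G] [BorelSpace G], IsCompactSimpleLieGroup G →
      ∀ (r : LatticeRep G) (β₀ m₀ : ℝ), 0 < β₀ → 0 < m₀ →
      ∃ κ : ℝ, 0 < κ ∧ ∃ S₁ : ℝ → ℝ → ℕ, ∀ A B : YMSpecies G, ∃ C : ℝ, ∀ β : ℝ, β₀ ≤ β →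
        ∀ m : ℝ, 0 < m → m ≤ m₀ →
          (∀ μ ∈ infiniteVolumeLimitPoints (d := 4) r.ρ β, ∃ K : ℝ, ∀ n : ℕ,
              covS r μ n ≤ K * Real.exp (-(m * n))) →
          ∀ S : ℕ, S₁ β m ≤ S → ∀ n : ℕ, n ≤ S →
            |latticeConnectedCorr r.ρ β (2 * S + 1) A.F B.F n| ≤ C * Real.exp (-(κ * m * n)) := by
  sorry

/-- **Stub 4 — the continuum limit on the peak trajectory (the UV/OS core, open-problem).** For
compact simple `G`, faithful `r`, a scale `T(β) ≥ 1` with `T(β) → ∞`: the volume-uniform torus gap of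
all pairs at rate `Δ₀/T(β)` (`TorusGapAtScale`) and aliveness of the scalar channel at the same scale
(`AliveAtScale`) give a weak-coupling scheme on the trajectory `a_k T(β_k) = θ` with a joint OS
continuum limit, non-trivial non-Gaussian curvature and Cauchy–Schwarz clustering at rate `Δ₀/θ`
(`PeakTrajectoryLimit`). -/
theorem stub_continuumLimitOnPeakTrajectory :
    ∀ (G : Type) [Group G] [TopologicalSpace G] [IsTopologicalGroup G] [CompactSpace G]
      [MeasurableSpace G] [BorelSpace G], IsCompactSimpleLieGroup G →
      ∀ (r : LatticeRep G) (β₀ Δ₀ δ : ℝ) (T : ℝ → ℕ) (S₁ : ℝ → ℕ), 0 < Δ₀ → 0 < δ →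
      (∀ β : ℝ, β₀ ≤ β → 1 ≤ T β) → Tendsto (fun β : ℝ => (T β : ℝ)) atTop atTop →
      TorusGapAtScale G r β₀ Δ₀ T S₁ → AliveAtScale G r β₀ δ T →
      PeakTrajectoryLimit G r β₀ Δ₀ T S₁ := by
  sorry

/-! ## Name-keyed aliases of the stub statements (hypotheses of `DefectRemainderToClay_of`)

The native skeleton audit (`#h21_check_skeleton`) admits a hypothesis of the skeleton theorem only if
its head constant is a registered obligation or is NAMED like a declared stub; `__Registered.stub_X`
is the statement of `stub_X` under that name (device of the registered birth skeletons, e.g.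
`Cruxes/ContinuumFromLatticeGap/Lines/birth.lean`). Each alias is syntactically its stub's statement. -/
namespace __Registered

/-- Statement of `stub_uniformPeak`, keyed by the stub name. -/
abbrev stub_uniformPeak : Prop :=
  ∀ (G : Type) [Group G] [TopologicalSpace G] [IsTopologicalGroup G] [CompactSpace G]
    [MeasurableSpace G] [BorelSpace G], IsCompactSimpleLieGroup G →
    ∀ (r : LatticeRep G) (t₀ : ℕ) (ℓ : ℝ → ℕ) (β₀ : ℝ), (∀ β : ℝ, β₀ ≤ β → t₀ < ℓ β) →
    (∀ β : ℝ, β₀ ≤ β → ∀ μ ∈ infiniteVolumeLimitPoints (d := 4) r.ρ β,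
        ∃ tstar : ℕ, ℓ β ≤ tstar ∧ IsPeak r t₀ μ tstar) →
    ∃ T : ℝ → ℕ, ∀ β : ℝ, β₀ ≤ β →
      (∀ μ ∈ infiniteVolumeLimitPoints (d := 4) r.ρ β, ∀ tstar : ℕ, t₀ ≤ tstar →
          IsPeak r t₀ μ tstar → tstar ≤ T β) ∧
      ∃ μ ∈ infiniteVolumeLimitPoints (d := 4) r.ρ β, ℓ β ≤ T β ∧ IsPeak r t₀ μ (T β)

/-- Statement of `stub_peakAlive`, keyed by the stub name. -/
abbrev stub_peakAlive : Prop :=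
  ∀ (G : Type) [Group G] [TopologicalSpace G] [IsTopologicalGroup G] [CompactSpace G]
    [MeasurableSpace G] [BorelSpace G], IsCompactSimpleLieGroup G →
    ∀ (r : LatticeRep G) (t₀ : ℕ), ∃ δ : ℝ, 0 < δ ∧ ∃ (β₁ : ℝ) (t₁ : ℕ), ∀ β : ℝ, β₁ ≤ β →
      ∀ μ ∈ infiniteVolumeLimitPoints (d := 4) r.ρ β, ∀ tstar : ℕ, t₀ < tstar → t₁ ≤ tstar →
        IsPeak r t₀ μ tstar → 0 < covS r μ tstar ∧ δ * covS r μ tstar ≤ covS r μ (2 * tstar)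

/-- Statement of `stub_scalarGapSetsLatticeGap`, keyed by the stub name. -/
abbrev stub_scalarGapSetsLatticeGap : Prop :=
  ∀ (G : Type) [Group G] [TopologicalSpace G] [IsTopologicalGroup G] [CompactSpace G]
    [MeasurableSpace G] [BorelSpace G], IsCompactSimpleLieGroup G →
    ∀ (r : LatticeRep G) (β₀ m₀ : ℝ), 0 < β₀ → 0 < m₀ →
    ∃ κ : ℝ, 0 < κ ∧ ∃ S₁ : ℝ → ℝ → ℕ, ∀ A B : YMSpecies G, ∃ C : ℝ, ∀ β : ℝ, β₀ ≤ β →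
      ∀ m : ℝ, 0 < m → m ≤ m₀ →
        (∀ μ ∈ infiniteVolumeLimitPoints (d := 4) r.ρ β, ∃ K : ℝ, ∀ n : ℕ,
            covS r μ n ≤ K * Real.exp (-(m * n))) →
        ∀ S : ℕ, S₁ β m ≤ S → ∀ n : ℕ, n ≤ S →
          |latticeConnectedCorr r.ρ β (2 * S + 1) A.F B.F n| ≤ C * Real.exp (-(κ * m * n))

/-- Statement of `stub_continuumLimitOnPeakTrajectory`, keyed by the stub name. -/
abbrev stub_continuumLimitOnPeakTrajectory : Prop :=
  ∀ (G : Type) [Group G] [TopologicalSpace G] [IsTopologicalGroup G] [CompactSpace G]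
    [MeasurableSpace G] [BorelSpace G], IsCompactSimpleLieGroup G →
    ∀ (r : LatticeRep G) (β₀ Δ₀ δ : ℝ) (T : ℝ → ℕ) (S₁ : ℝ → ℕ), 0 < Δ₀ → 0 < δ →
    (∀ β : ℝ, β₀ ≤ β → 1 ≤ T β) → Tendsto (fun β : ℝ => (T β : ℝ)) atTop atTop →
    TorusGapAtScale G r β₀ Δ₀ T S₁ → AliveAtScale G r β₀ δ T →
    PeakTrajectoryLimit G r β₀ Δ₀ T S₁

end __Registered

/-! ## Composition: the crux BY NAME from the four stub statements (no `sorry` below) -/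

/-- Monotonicity of an exponential decay bound in the length scale: a bound at scale `t` is a bound
at every larger scale `t'`, with the constant made non-negative. -/
theorem decay_mono {K c t t' : ℝ} (hc : 0 ≤ c) (ht : 0 < t) (htt' : t ≤ t') (n : ℕ) :
    K * Real.exp (-(c * n / t)) ≤ max K 0 * Real.exp (-(c / t' * n)) := by
  have hn : (0 : ℝ) ≤ n := Nat.cast_nonneg n
  have ht' : 0 < t' := lt_of_lt_of_le ht htt'
  have h1 : K * Real.exp (-(c * n / t)) ≤ max K 0 * Real.exp (-(c * n / t)) :=
    mul_le_mul_of_nonneg_right (le_max_left _ _) (Real.exp_pos _).le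
  refine h1.trans (mul_le_mul_of_nonneg_left ?_ (le_max_right _ _))
  rw [Real.exp_le_exp, neg_le_neg_iff, div_mul_eq_mul_div]
  exact div_le_div_of_nonneg_left (mul_nonneg hc hn) ht htt'

/-- **`DefectRemainderToClay_of`** — the crux BY NAME from the four stub statements under their
registered names; a real proof (see the module docstring for the chain). -/
theorem DefectRemainderToClay_of (h₁ : __Registered.stub_uniformPeak)
    (h₂ : __Registered.stub_peakAlive) (h₃ : __Registered.stub_scalarGapSetsLatticeGap)
    (h₄ : __Registered.stub_continuumLimitOnPeakTrajectory) :
    Summit.QuantumFields.YangMills.Theses.DualityDefect.DefectRemainderToClay := by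
  intro G _ _ _ _ _ _ hG r hX hP
  -- X₁ and X₂ at `(G, r)` (the crux's `let`-bound bodies, definitionally `Unimodal` / `PeakGap`)
  obtain ⟨β₀, t₀, ℓ, hℓ, hX⟩ := hX
  obtain ⟨β₀', c₁, t₀', hc₁, ht₀', hP⟩ := hP
  -- Stub 2: aliveness at every genuine peak beyond `t₁`, for `β ≥ β₁`
  obtain ⟨δ, hδ, β₁, t₁, hAlive⟩ := h₂ G hG r t₀
  -- the window eventually clears `t₀`, `t₀'`, `t₁`
  obtain ⟨β₂, hβ₂⟩ : ∃ β₂ : ℝ, ∀ β : ℝ, β₂ ≤ β → max (t₀ + 1) (max t₀' t₁) ≤ ℓ β :=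
    Filter.eventually_atTop.1 (Filter.tendsto_atTop.1 hℓ _)
  -- one working threshold
  obtain ⟨βs, hb₀, hb₀', hb₁, hb₂, hb1⟩ :
      ∃ βs : ℝ, β₀ ≤ βs ∧ β₀' ≤ βs ∧ β₁ ≤ βs ∧ β₂ ≤ βs ∧ 1 ≤ βs :=
    ⟨max (max β₀ β₀') (max (max β₁ β₂) 1), le_max_of_le_left (le_max_left _ _),
      le_max_of_le_left (le_max_right _ _),
      le_max_of_le_right (le_max_of_le_left (le_max_left _ _)),
      le_max_of_le_right (le_max_of_le_left (le_max_right _ _)),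
      le_max_of_le_right (le_max_right _ _)⟩
  have hℓ₁ : ∀ β : ℝ, βs ≤ β → t₀ + 1 ≤ ℓ β := fun β hβ =>
    (le_max_left _ _).trans (hβ₂ β (hb₂.trans hβ))
  have hℓ₂ : ∀ β : ℝ, βs ≤ β → t₀' ≤ ℓ β := fun β hβ =>
    ((le_max_left _ _).trans (le_max_right _ _)).trans (hβ₂ β (hb₂.trans hβ))
  have hℓ₃ : ∀ β : ℝ, βs ≤ β → t₁ ≤ ℓ β := fun β hβ =>
    ((le_max_right _ _).trans (le_max_right _ _)).trans (hβ₂ β (hb₂.trans hβ))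
  -- X₁ beyond the threshold
  have hXs : ∀ β : ℝ, βs ≤ β → ∀ μ ∈ infiniteVolumeLimitPoints (d := 4) r.ρ β,
      ∃ tstar : ℕ, ℓ β ≤ tstar ∧ IsPeak r t₀ μ tstar := fun β hβ => hX β (hb₀.trans hβ)
  -- Stub 1: the state-uniform, attained peak `T`
  obtain ⟨T, hT⟩ := h₁ G hG r t₀ ℓ βs (fun β hβ => hℓ₁ β hβ) hXs
  have hℓT : ∀ β : ℝ, βs ≤ β → ℓ β ≤ T β := fun β hβ => by
    obtain ⟨μ, -, hμ, -⟩ := (hT β hβ).2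
    exact hμ
  have hTge1 : ∀ β : ℝ, βs ≤ β → 1 ≤ T β := fun β hβ =>
    le_trans (Nat.succ_le_succ (Nat.zero_le _)) ((hℓ₁ β hβ).trans (hℓT β hβ))
  have hTpos : ∀ β : ℝ, βs ≤ β → (0 : ℝ) < T β := fun β hβ => by exact_mod_cast hTge1 β hβ
  -- X₂ at each state's own peak, transported to the scale `T β`: scalar decay at rate `c₁ / T β`
  have hdecay : ∀ β : ℝ, βs ≤ β → ∀ μ ∈ infiniteVolumeLimitPoints (d := 4) r.ρ β,
      ∃ K : ℝ, ∀ n : ℕ, covS r μ n ≤ K * Real.exp (-(c₁ / T β * n)) := by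
    intro β hβ μ hμ
    obtain ⟨tstar, hℓts, hpk⟩ := hXs β hβ μ hμ
    have hts₀' : t₀' ≤ tstar := (hℓ₂ β hβ).trans hℓts
    have hts₀ : t₀ ≤ tstar := (Nat.le_succ t₀).trans ((hℓ₁ β hβ).trans hℓts)
    have hmono : ∀ n : ℕ, tstar ≤ n →
        covP r μ (n + 1) * covS r μ n ≤ covP r μ n * covS r μ (n + 1) := by
      intro n hn
      rcases hn.eq_or_lt with heq | hlt
      · subst heq; exact hpk.2.1
      · exact (hpk.2.2 n hlt).le
    obtain ⟨K, hK⟩ := hP β (hb₀'.trans hβ) μ hμ tstar hts₀' hmono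
    have hle : (tstar : ℝ) ≤ T β := by exact_mod_cast (hT β hβ).1 μ hμ tstar hts₀ hpk
    have hts : (0 : ℝ) < tstar := by exact_mod_cast lt_of_lt_of_le ht₀' hts₀'
    exact ⟨max K 0, fun n => (hK n).trans (decay_mono hc₁.le hts hle n)⟩
  -- Stub 3: the torus gap of all pairs at rate `κ c₁ / T β`
  obtain ⟨κ, hκ, S₁, hS₁⟩ := h₃ G hG r βs c₁ (lt_of_lt_of_le one_pos hb1) hc₁
  have hgap : TorusGapAtScale G r βs (κ * c₁) T (fun β => S₁ β (c₁ / T β)) := by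
    intro A B
    obtain ⟨C, hC⟩ := hS₁ A B
    refine ⟨C, fun β hβ S hS n hn => ?_⟩
    have hm : 0 < c₁ / T β := div_pos hc₁ (hTpos β hβ)
    have hm' : c₁ / T β ≤ c₁ := div_le_self hc₁.le (by exact_mod_cast hTge1 β hβ)
    have h := hC β hβ (c₁ / T β) hm hm' (hdecay β hβ) S hS n hn
    rwa [← mul_div_assoc] at h
  -- Stub 2 at the maximal peak: aliveness at the scale `T β`
  have halive : AliveAtScale G r βs δ T := by
    intro β hβ
    obtain ⟨μ, hμ, hℓTβ, hpk⟩ := (hT β hβ).2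
    exact ⟨μ, hμ, hAlive β (hb₁.trans hβ) μ hμ (T β)
      (Nat.lt_of_lt_of_le (Nat.lt_succ_self t₀) ((hℓ₁ β hβ).trans hℓTβ))
      ((hℓ₃ β hβ).trans hℓTβ) hpk⟩
  -- the scale diverges: `T ≥ ℓ → ∞`
  have hTlim : Tendsto (fun β : ℝ => (T β : ℝ)) atTop atTop := by
    have hTnat : Tendsto T atTop atTop := by
      refine tendsto_atTop_mono' atTop ?_ hℓ
      filter_upwards [eventually_ge_atTop βs] with β hβ using hℓT β hβ
    exact tendsto_natCast_atTop_atTop.comp hTnat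
  -- Stub 4: the scheme and the OS data on the peak trajectory
  obtain ⟨sch, TT, θ, hθ, hW, hβk, hLk, hak, hY, hN₁, hN₂, hCS⟩ :=
    h₄ G hG r βs (κ * c₁) δ T (fun β => S₁ β (c₁ / T β)) (mul_pos hκ hc₁) hδ hTge1 hTlim
      hgap halive
  -- read off: continuum gap by the Cauchy–Schwarz transfer, lattice gap by transport along
  -- `a_k T(β_k) = θ`
  refine ⟨sch, TT, hW, hY, hN₁, hN₂, κ * c₁ / θ, div_pos (mul_pos hκ hc₁) hθ,
    hY.hasMassGap_of_hasCSClustering hCS, ?_⟩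
  intro A B
  obtain ⟨C, hC⟩ := hgap A B
  refine ⟨C, Filter.Eventually.of_forall fun k S hS n hn => ?_⟩
  have h := hC (sch.β k) (hβk k) S ((hLk k).trans hS) n hn
  have hT0 : (T (sch.β k) : ℝ) ≠ 0 := (hTpos _ (hβk k)).ne'
  have ha0 : sch.a k ≠ 0 := (sch.a_pos k).ne'
  have hθ' : θ = sch.a k * T (sch.β k) := (hak k).symm
  have heq : κ * c₁ / (T (sch.β k) : ℝ) * n = κ * c₁ / θ * (sch.a k * n) := by
    rw [hθ']; field_simp
  rwa [heq] at h

/-- Signature match: the registered stubs instantiate the hypotheses of the composition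
(kernel-checked; this `example` is the only place the sorried stubs are consumed). -/
example : Summit.QuantumFields.YangMills.Theses.DualityDefect.DefectRemainderToClay :=
  DefectRemainderToClay_of stub_uniformPeak stub_peakAlive stub_scalarGapSetsLatticeGap
    stub_continuumLimitOnPeakTrajectory

end Summit.QuantumFields.YangMills.Cruxes.DefectRemainderToClay.Birth

end
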